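import Mathlib
import Literature.NumberTheory.Transcendental.BlochWignerDilogarithm
import HarnessLib

/-!
# The Lobachevsky function: integrability of `log |2 sin u|`, `Л(π) = 0`, `π`-periodicity

Topic `Literature/NumberTheory/Transcendental`; support file for the discharge of the named fact
`Milnor1982_idealTetrahedronVolume` (Milnor 1982, Lemma 2) stated in
`BlochWignerDilogarithm.lean`. We prove the parts of Milnor's Lemma 1 (Milnor 1982, Appendix,
p. 17–18) that the volume computation uses:

* `intervalIntegrable_log_abs_two_mul_sin` — the integrand `u ↦ log |2 sin u|` of
  `Л(θ) = −∫₀^θ log |2 sin u| du` is interval integrable on every interval (it is `log ∘ f` for the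
  real-analytic `f = 2 sin`, Mathlib's `MeromorphicOn.intervalIntegrable_log`);
* `integral_log_abs_two_mul_sin_zero_pi` — `∫₀^π log |2 sin u| du = 0`, i.e. `Л(π) = 0`
  (from Mathlib's `∫₀^π log (sin u) du = −π log 2`);
* `lobachevsky_add_pi` — `Л(θ + π) = Л(θ)` (Milnor 1982, Lemma 1: "Л is odd, periodic of
  period π"), with the corollaries `Л(π − θ) = −Л(θ)`, `Л(θ − π) = Л(θ)`;
* `integral_log_abs_two_mul_sin_eq` — `∫ₐᵇ log |2 sin u| du = Л(a) − Л(b)` and its translate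
  `∫ₐᵇ log |2 sin (c + u)| du = Л(c + a) − Л(c + b)` (bookkeeping used in Milnor's proof of
  Lemma 2, p. 20).

Milnor's multiplication formula `Л(nθ) = n Σ Л(θ + kπ/n)` (the rest of Lemma 1) is not needed and
not proved here.

## References

* J. Milnor, *Hyperbolic geometry: the first 150 years*, Bull. AMS (N.S.) 6 (1982) 9–24:
  Appendix, Lemma 1, pp. 17–18. [`Milnor1982`]
-/

noncomputable section

open MeasureTheory intervalIntegral Set

namespace Literature.NumberTheory.Transcendental

/-- The integrand `u ↦ log |2 sin u|` of the Lobachevsky function is interval integrable on every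
interval (its singularities at `u ∈ πℤ` are logarithmic).
[cite: Milnor1982, Appendix, p. 17 (definition of Л) and Lemma 1] -/
theorem intervalIntegrable_log_abs_two_mul_sin (a b : ℝ) :
    IntervalIntegrable (fun u => Real.log |2 * Real.sin u|) volume a b := by
  have h : MeromorphicOn (fun u : ℝ => 2 * Real.sin u) (Set.uIcc a b) :=
    (analyticOnNhd_const.mul Real.analyticOnNhd_sin).meromorphicOn
  have hi := h.intervalIntegrable_log
  have heq : (Real.log ∘ fun u : ℝ => 2 * Real.sin u) = fun u => Real.log |2 * Real.sin u| := by
    funext u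
    rw [Function.comp_apply, Real.log_abs]
  rwa [heq] at hi

/-- Translates: `u ↦ log |2 sin (c + u)|` is interval integrable on every interval. [folklore] -/
theorem intervalIntegrable_log_abs_two_mul_sin_add (c a b : ℝ) :
    IntervalIntegrable (fun u => Real.log |2 * Real.sin (c + u)|) volume a b := by
  have h := (intervalIntegrable_log_abs_two_mul_sin (c + a) (c + b)).comp_add_left c
  simpa using h

/-- **`∫₀^π log |2 sin u| du = 0`** (equivalently `Л(π) = 0`; Milnor 1982, proof of Lemma 1:
"Л(π) − Л(0) = 0"). From `∫₀^π log (sin u) du = −π log 2`.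
[cite: Milnor1982, Appendix, Lemma 1 and its proof, pp. 17–18] -/
theorem integral_log_abs_two_mul_sin_zero_pi :
    ∫ u in (0 : ℝ)..Real.pi, Real.log |2 * Real.sin u| = 0 := by
  have h1 : ∫ u in (0 : ℝ)..Real.pi, Real.log |2 * Real.sin u| =
      ∫ u in (0 : ℝ)..Real.pi, (Real.log 2 + Real.log (Real.sin u)) := by
    rw [intervalIntegral.integral_of_le Real.pi_pos.le,
      intervalIntegral.integral_of_le Real.pi_pos.le, integral_Ioc_eq_integral_Ioo,
      integral_Ioc_eq_integral_Ioo]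
    refine setIntegral_congr_fun measurableSet_Ioo fun u hu => ?_
    have hsin : 0 < Real.sin u := Real.sin_pos_of_pos_of_lt_pi hu.1 hu.2
    rw [abs_of_pos (by positivity), Real.log_mul two_ne_zero hsin.ne']
  rw [h1, intervalIntegral.integral_add intervalIntegrable_const
    (by apply intervalIntegrable_log_sin), intervalIntegral.integral_const,
    integral_log_sin_zero_pi]
  simp only [sub_zero, smul_eq_mul]
  ring

/-- **`Л` is `π`-periodic**: `Л(θ + π) = Л(θ)` (Milnor 1982, Lemma 1: "Л(θ) is odd, periodic of
period π"). [cite: Milnor1982, Appendix, Lemma 1, p. 17] -/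
theorem lobachevsky_add_pi (θ : ℝ) : lobachevsky (θ + Real.pi) = lobachevsky θ := by
  have hper : Function.Periodic (fun u => Real.log |2 * Real.sin u|) Real.pi := fun u => by
    simp [Real.sin_add_pi, abs_neg]
  simp only [lobachevsky]
  rw [hper.intervalIntegral_add_eq_add 0 θ
      (fun _ _ => intervalIntegrable_log_abs_two_mul_sin _ _), zero_add,
    integral_log_abs_two_mul_sin_zero_pi, add_zero]

/-- `Л(π) = 0`. [cite: Milnor1982, Appendix, Lemma 1 (proof), p. 18] -/
@[simp] theorem lobachevsky_pi : lobachevsky Real.pi = 0 := by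
  simpa using lobachevsky_add_pi 0

/-- `Л(θ − π) = Л(θ)`. [cite: Milnor1982, Appendix, Lemma 1, p. 17] -/
theorem lobachevsky_sub_pi (θ : ℝ) : lobachevsky (θ - Real.pi) = lobachevsky θ := by
  simpa using (lobachevsky_add_pi (θ - Real.pi)).symm

/-- `Л(π − θ) = −Л(θ)` (odd and `π`-periodic). [cite: Milnor1982, Appendix, Lemma 1, p. 17] -/
theorem lobachevsky_pi_sub (θ : ℝ) : lobachevsky (Real.pi - θ) = -lobachevsky θ := by
  rw [← lobachevsky_neg, ← lobachevsky_add_pi (-θ)]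
  congr 1
  ring

/-- `Л` is periodic with period `π` (as a `Function.Periodic` statement).
[cite: Milnor1982, Appendix, Lemma 1, p. 17] -/
theorem lobachevsky_periodic : Function.Periodic lobachevsky Real.pi := lobachevsky_add_pi

/-- `∫ₐᵇ log |2 sin u| du = Л(a) − Л(b)`. [cite: Milnor1982, Appendix, p. 17 (definition of Л)] -/
theorem integral_log_abs_two_mul_sin_eq (a b : ℝ) :
    ∫ u in a..b, Real.log |2 * Real.sin u| = lobachevsky a - lobachevsky b := by
  have h := intervalIntegral.integral_interval_sub_left
    (intervalIntegrable_log_abs_two_mul_sin 0 b) (intervalIntegrable_log_abs_two_mul_sin 0 a)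
  simp only [lobachevsky]
  linarith

/-- `∫ₐᵇ log |2 sin (c + u)| du = Л(c + a) − Л(c + b)` (the bookkeeping step of Milnor's proof of
Lemma 2, p. 20). [cite: Milnor1982, Appendix, proof of Lemma 2, p. 20] -/
theorem integral_log_abs_two_mul_sin_add_eq (c a b : ℝ) :
    ∫ u in a..b, Real.log |2 * Real.sin (c + u)| = lobachevsky (c + a) - lobachevsky (c + b) := by
  rw [intervalIntegral.integral_comp_add_left (fun u => Real.log |2 * Real.sin u|) c,
    integral_log_abs_two_mul_sin_eq]

end Literature.NumberTheory.Transcendental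

end
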